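import Summits.CriticalPhenomena.PercolationContinuityZ3.Theorems.PercNearOneGluingNoHeavyPcintNawFreeMemSound
import HarnessLib

/-!
# PCINT lane, reduction B2d on the dangerous-set automaton — glue, lattice symmetry, table certificates

Cell `prim-pcint` (PAPER-2 track (iii)), seat `prim-pcint-1` (gen 6); support file (`--supports stmt-CriticalPhenomena-4575`).
Does NOT build on p205010.  Memo: run/shared/lean/prim/pcint/REDUCTIONS.md §B2d.

`le_siteCriticalProb_zd_of_freeMem_total` (geometric totals ⇒ `p ≤ p_c^site(ℤ^d)`); equivariance of the known set under the
hyperoctahedral group (`fK_smul`) and invariance of every derived quantity (`fcnt_smul`, `fnpay_smul`, `funcond_smul`,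
`fcond_smul`, `fU_smul`, `fC_smul`, `fwt_smul`, `total_freeMemAut_smul`); table certificates modulo symmetry (`ftableAut`,
`total_ftableAut_eq`, `total_freeMemAut_le_of_table`, `le_siteCriticalProb_zd_of_freeMemTable`), reusing `simRel`.
-/

noncomputable section

namespace Summit.CriticalPhenomena.PercolationContinuityZ3.Theorems.Pcint

open Finset Literature.Probability.Percolation Literature.Probability.LatticeModels

variable {{d : ℕ}}

/-! ### The glue: geometric totals give a lower bound on `p_c^site(ℤ^d)` -/

section Glue

variable {τ kt : ℕ}

/-- **Reduced-state B2d certificate ⇒ `p ≤ p_c^site(ℤ^d)`** (totals of `freeMemAut` from `∅` geometrically small). [folklore] -/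
theorem le_siteCriticalProb_zd_of_freeMem_total [NeZero d] (hτ : 2 ≤ τ) (hkt : 2 * kt ≤ τ) (hkt2 : 2 ≤ kt) (p : unitInterval)
    {qv : ℕ → ℝ} {C r : ℝ} (hq0 : ∀ k, 0 ≤ qv k) (hq1 : ∀ k, qv k ≤ 1) (hmono : ∀ k k', k ≤ k' → qv k ≤ qv k')
    (hpq : ∀ k, k ≤ 2 * d → 1 - (p : ℝ) ≤ qv k ^ k) (hr0 : 0 ≤ r) (hr : r < 1)
    (htot : ∀ n, (freeMemAut τ kt p qv p.2.1 hq0).total n (∅ : MState d) ≤ C * r ^ n) :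
    (p : ℝ) ≤ siteCriticalProb (zdGraph d) 0 := by
  have a₀ : Fin d × Bool := (⟨0, NeZero.pos d⟩, true)
  have ht : Filter.Tendsto (fun n : ℕ => (p : ℝ) * C * r ^ n) Filter.atTop (nhds 0) := by
    simpa using (tendsto_pow_atTop_nhds_zero_of_lt_one hr0 hr).const_mul ((p : ℝ) * C)
  have h0 : siteTheta (zdGraph d) 0 p = 0 := by
    refine le_antisymm (ge_of_tendsto' ht fun n => ?_) MeasureTheory.measureReal_nonneg
    calc siteTheta (zdGraph d) 0 p ≤ (p : ℝ) * (freeMemAut τ kt p qv p.2.1 hq0).total n (∅ : MState d) :=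
          siteTheta_le_freeMem_total a₀ hτ hkt hkt2 p hq0 hq1 hmono hpq n
      _ ≤ (p : ℝ) * (C * r ^ n) := mul_le_mul_of_nonneg_left (htot n) p.2.1
      _ = (p : ℝ) * C * r ^ n := by ring
  refine le_csInf ⟨1, Or.inr rfl⟩ ?_
  rintro r' (⟨hr', hθ⟩ | hr')
  · by_contra hlt
    push Not at hlt
    have hmono' := siteTheta_mono (G := zdGraph d) (0 : Site d) (show (⟨r', hr'⟩ : unitInterval) ≤ p from hlt.le)
    exact hθ.not_ge (hmono'.trans_eq h0)
  · rw [Set.mem_singleton_iff] at hr'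
    rw [hr']
    exact p.2.2

end Glue

/-! ### Lattice symmetry: the known set is equivariant, the weights are invariant -/

section FreeSymmetry

variable (τ kt : ℕ)

/-- The action on (site, age) pairs. [folklore] -/
def smulPair (g : SPerm d) (q : Site d × ℕ) : Site d × ℕ := (smulSite g q.1, q.2)

/-- `smulPair` is injective. [folklore] -/
theorem smulPair_injective (g : SPerm d) : Function.Injective (smulPair (d := d) g) := by
  rintro ⟨x, A⟩ ⟨y, B⟩ h
  simp only [smulPair, Prod.mk.injEq] at h
  exact Prod.ext (smulSite_injective g h.1) h.2

/-- `smulSite g 0 = 0`. [folklore] -/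
private theorem smulSite_zero_aux (g : SPerm d) : smulSite g (0 : Site d) = 0 := by
  have := smulSite_sub g (0 : Site d) 0
  rwa [sub_self, sub_self] at this

/-- **The known set is equivariant.** [folklore] -/
theorem fK_smul (g : SPerm d) (S : MState d) (a : Fin d × Bool) :
    fK (smulState g S) (smulLetter g a) = (fK S a).image (smulPair g) := by
  unfold fK smulState
  rw [image_insert, image_insert, image_image, image_image, stepVec_smulLetter]
  simp only [smulPair, smulSite_zero_aux, smulSite_neg]
  congr 2
  refine image_congr fun q _ => ?_
  simp only [Function.comp_apply, smulSite_sub, smulPair]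

/-- Membership in the transformed known set. [folklore] -/
theorem mem_fK_smul (g : SPerm d) (S : MState d) (a : Fin d × Bool) (q : Site d × ℕ) :
    q ∈ fK (smulState g S) (smulLetter g a) ↔ ∃ r, (r, q.2) ∈ fK S a ∧ q.1 = smulSite g r := by
  rw [fK_smul, mem_image]
  constructor
  · rintro ⟨r, hr, rfl⟩; exact ⟨r.1, hr, rfl⟩
  · rintro ⟨r, hr, hq⟩
    refine ⟨(r, q.2), hr, ?_⟩
    rw [smulPair, ← hq]

/-- The known positions are equivariant. [folklore] -/
theorem mem_fpos_smul (g : SPerm d) (S : MState d) (a : Fin d × Bool) (x : Site d) :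
    smulSite g x ∈ fpos (smulState g S) (smulLetter g a) ↔ x ∈ fpos S a := by
  rw [mem_fpos, mem_fpos]
  constructor
  · rintro ⟨A, hA⟩
    obtain ⟨r, hr, hx⟩ := (mem_fK_smul g S a _).1 hA
    rw [smulSite_injective g hx]; exact ⟨A, hr⟩
  · rintro ⟨A, hA⟩
    exact ⟨A, (mem_fK_smul g S a _).2 ⟨x, hA, rfl⟩⟩

/-- Visible incidences are equivariant. [folklore] -/
theorem finc_smul (g : SPerm d) (S : MState d) (a : Fin d × Bool) (w : Site d) :
    finc (smulState g S) (smulLetter g a) (smulSite g w) = (finc S a w).image (smulPair g) := by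
  ext q
  rw [mem_finc, mem_image, mem_fK_smul]
  constructor
  · rintro ⟨⟨r, hr, hq⟩, hadj⟩
    refine ⟨(r, q.2), mem_finc.2 ⟨hr, ?_⟩, by rw [smulPair, ← hq]⟩
    rw [hq] at hadj; exact (adj_smulSite_iff g _ _).1 hadj
  · rintro ⟨r, hr, rfl⟩
    obtain ⟨hrK, hadj⟩ := mem_finc.1 hr
    exact ⟨⟨r.1, hrK, rfl⟩, (adj_smulSite_iff g _ _).2 hadj⟩

/-- A property of the ages of the visible incidences transfers (existential form). [folklore] -/
theorem exists_finc_smul_iff (g : SPerm d) (S : MState d) (a : Fin d × Bool) (w : Site d) (P : ℕ → Prop) :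
    (∃ q ∈ finc (smulState g S) (smulLetter g a) (smulSite g w), P q.2) ↔ ∃ q ∈ finc S a w, P q.2 := by
  rw [finc_smul]
  constructor
  · rintro ⟨q, hq, hP⟩
    obtain ⟨r, hr, rfl⟩ := mem_image.1 hq
    exact ⟨r, hr, hP⟩
  · rintro ⟨q, hq, hP⟩
    exact ⟨smulPair g q, mem_image_of_mem _ hq, hP⟩

/-- Certification is invariant. [folklore] -/
theorem fcert_smul (g : SPerm d) (S : MState d) (a : Fin d × Bool) (u : Site d) :
    fcert τ (smulState g S) (smulLetter g a) (smulSite g u) = fcert τ S a u := by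
  rw [Bool.eq_iff_iff, fcert_iff, fcert_iff, l1_smulSite]
  constructor
  · rintro ⟨q, hq, h1, h2, hadj⟩
    obtain ⟨r, hr, hq1⟩ := (mem_fK_smul g S a q).1 hq
    refine ⟨(r, q.2), hr, h1, h2, ?_⟩
    rw [hq1] at hadj; exact (adj_smulSite_iff g _ _).1 hadj
  · rintro ⟨q, hq, h1, h2, hadj⟩
    exact ⟨smulPair g q, (mem_fK_smul g S a _).2 ⟨q.1, hq, rfl⟩, h1, h2, (adj_smulSite_iff g _ _).2 hadj⟩

/-- Free neighbours are equivariant. [folklore] -/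
theorem ffree_smul (g : SPerm d) (S : MState d) (a : Fin d × Bool) (w : Site d) :
    ffree τ (smulState g S) (smulLetter g a) (smulSite g w) = (ffree τ S a w).image (smulSite g) := by
  ext u
  rw [mem_ffree, mem_image]
  constructor
  · rintro ⟨hadj, hpos, hcert⟩
    have hu : u ∈ (nbrSites w).image (smulSite g) := by rw [← nbrSites_smulSite]; exact mem_nbrSites.2 hadj
    obtain ⟨v, hv, rfl⟩ := mem_image.1 hu
    refine ⟨v, (mem_ffree τ).2 ⟨mem_nbrSites.1 hv, fun h => hpos ((mem_fpos_smul g S a v).2 h), ?_⟩, rfl⟩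
    rw [← fcert_smul τ g]; exact hcert
  · rintro ⟨v, hv, rfl⟩
    obtain ⟨hadj, hpos, hcert⟩ := (mem_ffree τ).1 hv
    exact ⟨(adj_smulSite_iff g _ _).2 hadj, fun h => hpos ((mem_fpos_smul g S a v).1 h), by rw [fcert_smul]; exact hcert⟩

/-- The count is invariant. [folklore] -/
theorem fcnt_smul (g : SPerm d) (S : MState d) (a : Fin d × Bool) (w : Site d) :
    fcnt τ (smulState g S) (smulLetter g a) (smulSite g w) = fcnt τ S a w := by
  unfold fcnt
  rw [finc_smul, ffree_smul, card_image_of_injective _ (smulPair_injective g), card_image_of_injective _ (smulSite_injective g)]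

/-- `fprepay` is invariant. [folklore] -/
theorem fprepay_smul (g : SPerm d) (S : MState d) (a : Fin d × Bool) (w : Site d) :
    fprepay kt (smulState g S) (smulLetter g a) (smulSite g w) = fprepay kt S a w := by
  rw [Bool.eq_iff_iff, fprepay_iff, fprepay_iff]
  exact exists_finc_smul_iff g S a w (fun j => j + 2 = kt)

/-- `fself` is invariant. [folklore] -/
theorem fself_smul (g : SPerm d) (S : MState d) (a : Fin d × Bool) (w : Site d) :
    fself τ kt (smulState g S) (smulLetter g a) (smulSite g w) = fself τ kt S a w := by
  rw [Bool.eq_iff_iff, fself_iff, fself_iff, l1_smulSite, finc_smul, card_image_of_injective _ (smulPair_injective g)]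
  have h : (∀ q ∈ (finc S a w).image (smulPair g), q.2 ≠ kt + 2) ↔ ∀ q ∈ finc S a w, q.2 ≠ kt + 2 := by
    constructor
    · intro h q hq; exact h (smulPair g q) (mem_image_of_mem _ hq)
    · intro h q hq
      obtain ⟨r, hr, rfl⟩ := mem_image.1 hq
      exact h r hr
  rw [h]

/-- `funcond` is invariant. [folklore] -/
theorem funcond_smul (g : SPerm d) (S : MState d) (a : Fin d × Bool) (w : Site d) :
    funcond (smulState g S) (smulLetter g a) (smulSite g w) = funcond S a w := by
  rw [Bool.eq_iff_iff, funcond_iff, funcond_iff, finc_smul]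
  constructor
  · rintro ⟨q, hq, q', hq', h⟩
    obtain ⟨r, hr, rfl⟩ := mem_image.1 hq
    obtain ⟨r', hr', rfl⟩ := mem_image.1 hq'
    exact ⟨r, hr, r', hr', h⟩
  · rintro ⟨q, hq, q', hq', h⟩
    exact ⟨smulPair g q, mem_image_of_mem _ hq, smulPair g q', mem_image_of_mem _ hq', h⟩

/-- `fcorner` is invariant. [folklore] -/
theorem fcorner_smul (g : SPerm d) (S : MState d) (a : Fin d × Bool) (w : Site d) :
    fcorner kt (smulState g S) (smulLetter g a) (smulSite g w) = fcorner kt S a w := by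
  rw [Bool.eq_iff_iff, fcorner_iff, fcorner_iff]
  constructor
  · rintro ⟨P, x₁, x₂, hP, h1, h2, hw⟩
    obtain ⟨P', hP', hPe⟩ := (mem_fK_smul g S a _).1 hP
    obtain ⟨y₁, hy₁, h1e⟩ := (mem_fK_smul g S a _).1 h1
    obtain ⟨y₂, hy₂, h2e⟩ := (mem_fK_smul g S a _).1 h2
    simp only at hPe h1e h2e
    refine ⟨P', y₁, y₂, hP', hy₁, hy₂, smulSite_injective g ?_⟩
    rw [hw, hPe, h1e, h2e, smulSite_sub, smulSite_add]
  · rintro ⟨P, x₁, x₂, hP, h1, h2, hw⟩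
    refine ⟨smulSite g P, smulSite g x₁, smulSite g x₂, (mem_fK_smul g S a _).2 ⟨P, hP, rfl⟩,
      (mem_fK_smul g S a _).2 ⟨x₁, h1, rfl⟩, (mem_fK_smul g S a _).2 ⟨x₂, h2, rfl⟩, ?_⟩
    rw [hw, smulSite_sub, smulSite_add]

/-- `fcond` is invariant. [folklore] -/
theorem fcond_smul (g : SPerm d) (S : MState d) (a : Fin d × Bool) (w : Site d) :
    fcond kt (smulState g S) (smulLetter g a) (smulSite g w) = fcond kt S a w := by
  unfold fcond; rw [funcond_smul, fcorner_smul]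

/-- `fnpay` is invariant. [folklore] -/
theorem fnpay_smul (g : SPerm d) (S : MState d) (a : Fin d × Bool) (w : Site d) :
    fnpay τ kt (smulState g S) (smulLetter g a) (smulSite g w) = fnpay τ kt S a w := by
  unfold fnpay; rw [fprepay_smul, fself_smul]

/-- The inspected sites are equivariant. [folklore] -/
theorem fsites_smul (g : SPerm d) (S : MState d) (a : Fin d × Bool) :
    fsites kt (smulState g S) (smulLetter g a) = (fsites kt S a).image (smulSite g) := by
  ext w
  rw [mem_fsites, mem_image]
  constructor
  · rintro ⟨P, hP, hadj, hw⟩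
    obtain ⟨P', hP', hPe⟩ := (mem_fK_smul g S a _).1 hP
    simp only at hPe
    rw [hPe] at hadj
    have hu : w ∈ (nbrSites P').image (smulSite g) := by rw [← nbrSites_smulSite]; exact mem_nbrSites.2 hadj
    obtain ⟨v, hv, rfl⟩ := mem_image.1 hu
    exact ⟨v, (mem_fsites kt).2 ⟨P', hP', mem_nbrSites.1 hv, fun h => hw ((mem_fpos_smul g S a v).2 h)⟩, rfl⟩
  · rintro ⟨v, hv, rfl⟩
    obtain ⟨P, hP, hadj, hw⟩ := (mem_fsites kt).1 hv
    exact ⟨smulSite g P, (mem_fK_smul g S a _).2 ⟨P, hP, rfl⟩, (adj_smulSite_iff g _ _).2 hadj,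
      fun h => hw ((mem_fpos_smul g S a v).1 h)⟩

/-- `fU` is invariant. [folklore] -/
theorem fU_smul (qv : ℕ → ℝ) (g : SPerm d) (S : MState d) (a : Fin d × Bool) :
    fU τ kt qv (smulState g S) (smulLetter g a) = fU τ kt qv S a := by
  unfold fU
  rw [fsites_smul, prod_image (fun x _ y _ h => smulSite_injective g h)]
  refine prod_congr rfl fun w _ => ?_
  rw [funcond_smul, fcnt_smul, fnpay_smul]

/-- `fC` is invariant. [folklore] -/
theorem fC_smul (qv : ℕ → ℝ) (g : SPerm d) (S : MState d) (a : Fin d × Bool) :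
    fC τ kt qv (smulState g S) (smulLetter g a) = fC τ kt qv S a := by
  unfold fC
  rw [fsites_smul, prod_image (fun x _ y _ h => smulSite_injective g h)]
  refine prod_congr rfl fun w _ => ?_
  rw [fcond_smul, fcnt_smul, fnpay_smul]

/-- `fhasC` is invariant. [folklore] -/
theorem fhasC_smul (g : SPerm d) (S : MState d) (a : Fin d × Bool) :
    fhasC τ kt (smulState g S) (smulLetter g a) = fhasC τ kt S a := by
  rw [Bool.eq_iff_iff, fhasC_iff, fhasC_iff, fsites_smul]
  constructor
  · rintro ⟨w, hw, hc, hp⟩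
    obtain ⟨v, hv, rfl⟩ := mem_image.1 hw
    rw [fcond_smul, fnpay_smul] at *
    exact ⟨v, hv, hc, hp⟩
  · rintro ⟨v, hv, hc, hp⟩
    exact ⟨smulSite g v, mem_image_of_mem _ hv, by rw [fcond_smul]; exact hc, by rw [fnpay_smul]; exact hp⟩

/-- **The step factor is invariant.** [folklore] -/
theorem fwt_smul (qv : ℕ → ℝ) (g : SPerm d) (S : MState d) (a : Fin d × Bool) :
    fwt τ kt qv (smulState g S) (smulLetter g a) = fwt τ kt qv S a := by
  unfold fwt; rw [fU_smul, fC_smul, fhasC_smul]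

variable {τ kt}

/-- Row sums of `freeMemAut` against an invariant function are invariant. [folklore] -/
theorem stepSum_freeMemAut_smul {p : ℝ} {qv : ℕ → ℝ} (hp : 0 ≤ p) (hq : ∀ k, 0 ≤ qv k) (g : SPerm d) {f : MState d → ℝ}
    (hf : ∀ T, f (smulState g T) = f T) (S : MState d) :
    (freeMemAut τ kt p qv hp hq).stepSum f (smulState g S) = (freeMemAut τ kt p qv hp hq).stepSum f S := by
  unfold WAut.stepSum
  rw [← Equiv.sum_comp (letterEquiv g)]
  refine Finset.sum_congr rfl fun a _ => ?_
  have h1 : (freeMemAut τ kt p qv hp hq).step (smulState g S) (letterEquiv g a) =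
      ((freeMemAut τ kt p qv hp hq).step S a).map (smulState g) := nstep_smul τ g S a
  have h2 : (freeMemAut τ kt p qv hp hq).wt (smulState g S) (letterEquiv g a) = (freeMemAut τ kt p qv hp hq).wt S a := by
    show p * fwt τ kt qv (smulState g S) (smulLetter g a) = p * fwt τ kt qv S a
    rw [fwt_smul]
  rw [h1, h2]
  cases (freeMemAut τ kt p qv hp hq).step S a with
  | none => rfl
  | some T => simp only [Option.map_some, hf]

/-- **Totals of the B2d automaton are invariant under lattice symmetries.** [folklore] -/
theorem total_freeMemAut_smul {p : ℝ} {qv : ℕ → ℝ} (hp : 0 ≤ p) (hq : ∀ k, 0 ≤ qv k) (g : SPerm d) :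
    ∀ (n : ℕ) (S : MState d),
      (freeMemAut τ kt p qv hp hq).total n (smulState g S) = (freeMemAut τ kt p qv hp hq).total n S := by
  intro n
  induction n with
  | zero => intro S; rw [WAut.total_zero, WAut.total_zero]
  | succ n ih =>
    intro S
    rw [WAut.total_succ, WAut.total_succ]
    exact stepSum_freeMemAut_smul hp hq g (fun T => ih T) S

end FreeSymmetry

/-! ### Table certificates for the B2d automaton -/

section FreeTable

variable {τ kt N : ℕ}

/-- The index automaton of a table, with the B2d weights recomputed from the rows' states. [folklore] -/
def ftableAut (τ kt : ℕ) (p : ℝ) (qv : ℕ → ℝ) (hp : 0 ≤ p) (hq : ∀ k, 0 ≤ qv k) (R : Fin N → MState d)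
    (sc : Fin N → Fin d × Bool → Option (Fin N × SPerm d)) : WAut (Fin N) (Fin d × Bool) where
  step i a := (sc i a).map Prod.fst
  wt i a := (freeMemAut τ kt p qv hp hq).wt (R i) a
  wt_nonneg i a := (freeMemAut τ kt p qv hp hq).wt_nonneg (R i) a

/-- **Simulation** for the B2d automaton. [folklore] -/
theorem total_ftableAut_eq {p : ℝ} {qv : ℕ → ℝ} (hp : 0 ≤ p) (hq : ∀ k, 0 ≤ qv k) (R : Fin N → MState d)
    (sc : Fin N → Fin d × Bool → Option (Fin N × SPerm d)) (hsim : ∀ i a, simRel R (nstep τ (R i) a) (sc i a) = true) :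
    ∀ (n : ℕ) (i : Fin N), (ftableAut τ kt p qv hp hq R sc).total n i = (freeMemAut τ kt p qv hp hq).total n (R i) := by
  intro n
  induction n with
  | zero => intro i; rw [WAut.total_zero, WAut.total_zero]
  | succ n ih =>
    intro i
    rw [WAut.total_succ, WAut.total_succ]
    unfold WAut.stepSum
    refine Finset.sum_congr rfl fun a _ => ?_
    have h := hsim i a
    have e1 : (ftableAut τ kt p qv hp hq R sc).step i a = (sc i a).map Prod.fst := rfl
    have e2 : (freeMemAut τ kt p qv hp hq).step (R i) a = nstep τ (R i) a := rfl
    rw [e1, e2]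
    revert h
    generalize nstep τ (R i) a = oT
    generalize sc i a = oJ
    intro h
    cases oT with
    | none =>
      cases oJ with
      | none => rfl
      | some jg => exact absurd h (by simp [simRel])
    | some T =>
      cases oJ with
      | none => exact absurd h (by simp [simRel])
      | some jg =>
        have hT : T = smulState jg.2 (R jg.1) := by simpa [simRel] using h
        simp only [Option.map_some]
        rw [ih jg.1, hT, total_freeMemAut_smul]
        rfl

/-- **Table certificate ⇒ geometric bound on the totals of `freeMemAut`.** [folklore] -/
theorem total_freeMemAut_le_of_table {p lam : ℝ} {qv : ℕ → ℝ} (hp : 0 ≤ p) (hq : ∀ k, 0 ≤ qv k) (hlam : 0 ≤ lam)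
    (R : Fin N → MState d) (sc : Fin N → Fin d × Bool → Option (Fin N × SPerm d)) (V : Fin N → ℝ) (hV : ∀ i, 1 ≤ V i)
    (hsim : ∀ i a, simRel R (nstep τ (R i) a) (sc i a) = true)
    (hcw : ∀ i, (∑ a : Fin d × Bool, match sc i a with
      | none => 0
      | some jg => p * fwt τ kt qv (R i) a * V jg.1) ≤ lam * V i) (n : ℕ) (i : Fin N) :
    (freeMemAut τ kt p qv hp hq).total n (R i) ≤ lam ^ n * V i := by
  rw [← total_ftableAut_eq hp hq R sc hsim n i]
  have hcw' : ∀ i, (ftableAut τ kt p qv hp hq R sc).stepSum V i ≤ lam * V i := fun i => by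
    refine le_of_eq_of_le ?_ (hcw i)
    unfold WAut.stepSum
    refine Finset.sum_congr rfl fun a _ => ?_
    have e1 : (ftableAut τ kt p qv hp hq R sc).step i a = (sc i a).map Prod.fst := rfl
    rw [e1]
    cases sc i a with
    | none => rfl
    | some jg => rfl
  have := (ftableAut τ kt p qv hp hq R sc).total_le_of_cw one_pos hV hlam hcw' n i
  rwa [div_one] at this

/-- **Reduced-state B2d certificate (table form) ⇒ `p ≤ p_c^site(ℤ^d)`.** [folklore] -/
theorem le_siteCriticalProb_zd_of_freeMemTable [NeZero d] (hτ : 2 ≤ τ) (hkt : 2 * kt ≤ τ) (hkt2 : 2 ≤ kt)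
    (p : unitInterval) {qv : ℕ → ℝ} {lam : ℝ} (hq0 : ∀ k, 0 ≤ qv k) (hq1 : ∀ k, qv k ≤ 1)
    (hmono : ∀ k k', k ≤ k' → qv k ≤ qv k') (hpq : ∀ k, k ≤ 2 * d → 1 - (p : ℝ) ≤ qv k ^ k)
    (hlam0 : 0 ≤ lam) (hlam1 : lam < 1)
    (R : Fin N → MState d) (sc : Fin N → Fin d × Bool → Option (Fin N × SPerm d)) (V : Fin N → ℝ)
    (i₀ : Fin N) (h0 : R i₀ = ∅) (hV : ∀ i, 1 ≤ V i) (hsim : ∀ i a, simRel R (nstep τ (R i) a) (sc i a) = true)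
    (hcw : ∀ i, (∑ a : Fin d × Bool, match sc i a with
      | none => 0
      | some jg => (p : ℝ) * fwt τ kt qv (R i) a * V jg.1) ≤ lam * V i) :
    (p : ℝ) ≤ siteCriticalProb (zdGraph d) 0 := by
  refine le_siteCriticalProb_zd_of_freeMem_total hτ hkt hkt2 p hq0 hq1 hmono hpq hlam0 hlam1 (C := V i₀) fun n => ?_
  have h := total_freeMemAut_le_of_table p.2.1 hq0 hlam0 R sc V hV hsim hcw n i₀
  rw [h0] at h
  exact h.trans_eq (mul_comm _ _)

end FreeTable

end Summit.CriticalPhenomena.PercolationContinuityZ3.Theorems.Pcint
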